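import Literature.AlgebraicGeometry.HodgeTheory.HodgeIndexDivisorClassesRational
import Literature.AlgebraicGeometry.HodgeTheory.LefschetzFormsSignatureHodgeNumbers
import Literature.AlgebraicTopology.SingularHomology.UniversalCoefficientsField
import Literature.AlgebraicTopology.SingularHomology.BettiNumberBaseChange
import HarnessLib

/-!
# The Sylvester indices of the rational Lefschetz forms `Q_k` on `Hᵏ(X(ℂ); ℚ)` are the real ones

Family `hodge`, layer `Literature/AlgebraicGeometry/HodgeTheory`; lane `lit-hodgefound`. THEOREMS
ONLY (no definition, no named fact; D-0026). Sequel of `HodgeIndexDivisorClassesRational.lean`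
(`B_ℝ(a ⊗ ℝ, b ⊗ ℝ) = B_ℚ(a, b)` in every degree, `dim_ℝ span_ℝ (W ⊗ ℝ) = dim_ℚ W`), of
`Literature/LinearAlgebra/QuadraticForm/SignatureBaseChange.lean` (the indices of inertia do not
change under an ordered field extension — Sylvester, Lang V §8 Thm. 8.2) and of the real index
theorems `HodgeIndexTheoremLefschetzForms.lean` / `LefschetzFormsSignatureHodgeNumbers.lean`
(Voisin I Thm. 6.32 / 6.33 on `Hᵏ(X(ℂ); ℝ)`).

For `X` smooth projective over `ℂ` of dimension `n`, a Kähler–rational datum `D` with RATIONAL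
Kähler class `η ∈ H²(X(ℂ); ℚ)`, a `ℤ`-orientation `μ` of `X(ℂ)` and `k` even with `k + 2r = m`,
`m + k = 2n`, the rational Lefschetz form `B_ℚ(a, b) = ⟨Lʳ_η a ⌣ b, [X(ℂ)]_μ ⊗ 1_ℚ⟩` on the WHOLE of
`Hᵏ(X(ℂ); ℚ)` is the `ℚ`-structure of the real form `B_ℝ` on `Hᵏ(X(ℂ); ℝ) = Hᵏ(X(ℂ); ℚ) ⊗ ℝ`:

* `span_range_coeffClass_rat_real_eq_top` — `Hᵏ(Y; ℝ)` is spanned by the classes `a ⊗ ℝ`,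
  `a ∈ Hᵏ(Y; ℚ)` (universal coefficients: `dim_ℚ Hᵏ(Y; ℚ) = b_k = dim_ℝ Hᵏ(Y; ℝ)`,
  `bettiNumber_eq_of_algebra`);
* **`KaehlerRationalDatum.sigPos_sigNeg_lefschetzFormRat_eq_real`** — **`b^±(B_ℚ) = b^±(B_ℝ)`**
  (Sylvester's indices read over the ordered field `ℚ` and over `ℝ`);
* hence every real index theorem of the tree holds verbatim over `ℚ`:
  `….sigPos_sigNeg_lefschetzFormRat_eq_sum_of_pos` (the block parity sums of Voisin I Thm. 6.32),
  **`….sigPos_add_sigNeg_lefschetzFormRat_eq_bettiNumber`** (`b⁺ + b⁻ = b_k(X)`: `B_ℚ` is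
  non-degenerate on `Hᵏ(X(ℂ); ℚ)`, `k ≤ n` even),
  **`….signature_lefschetzFormRat_eq_sum_hodgeNumber`** (the signature in Hodge numbers, Voisin I
  Thm. 6.33 / (6.12)–(6.13)), `….sigPos_sigNeg_lefschetzFormRat_two_of_pos`
  (`(2h^{2,0} + 1, h^{1,1} - 1)` on `H²(X(ℂ); ℚ)`, every `n ≥ 2`).

## References

* [VoisinHodgeI2002] C. Voisin, Hodge Theory and Complex Algebraic Geometry I (CUP 2002), §6.3.2
  Thm. 6.32 and Thm. 6.33, §7.1.1 (`Hᵏ(X, ℚ) ⊗ ℂ = Hᵏ(X, ℂ)`).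
* [Lang1987LinearAlgebra] S. Lang, Linear Algebra (3rd ed., 1987), Ch. V §8 Thm. 8.2.
* [HatcherAT2002] A. Hatcher, Algebraic Topology (CUP 2002), §3.1 Thm. 3.2, p. 198, §3.A Thm. 3A.3.
* [HuybrechtsCG2005] D. Huybrechts, Complex Geometry (Springer 2005), §3.3 Cor. 3.3.16.
-/

noncomputable section

open scoped Manifold ContDiff
open CategoryTheory AlgebraicGeometry Module Bundle Finset
open Literature.AlgebraicTopology.SingularHomology Literature.Geometry.Kaehler
open Literature.NumberTheory.Transcendental
open Literature.AlgebraicGeometry.Motives (IsSmoothProjective)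

namespace Literature.AlgebraicGeometry.HodgeTheory

/-! ### `Hᵏ(Y; ℝ)` is spanned by the rational classes -/

section Span

variable {Y : Type} [TopologicalSpace Y]

/-- **`Hᵏ(Y; ℝ) = span_ℝ {a ⊗ ℝ | a ∈ Hᵏ(Y; ℚ)}`** when the cohomology is finite-dimensional: the
real span of the image of `Hᵏ(Y; ℚ)` has dimension `dim_ℚ Hᵏ(Y; ℚ)`
(`finrank_span_coeffClass_image_eq`), which is the Betti number `b_k(Y)` over `ℚ` and over `ℝ`
(universal coefficients over fields, `bettiNumber_eq_of_algebra`), i.e. `dim_ℝ Hᵏ(Y; ℝ)`.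
[cite: HatcherAT2002, §3.A Thm. 3A.3 and §3.1 p. 198] [cite: VoisinHodgeI2002, §7.1.1] -/
theorem span_range_coeffClass_rat_real_eq_top {k : ℕ} [Module.Finite ℚ (singularCohomology ℚ ℚ Y k)]
    [Module.Finite ℝ (singularCohomology ℝ ℝ Y k)] :
    Submodule.span ℝ (Set.range (coeffClass (R := ℚ) (S := ℝ) (Rat.castHom ℝ).toAddMonoidHom k :
        singularCohomology ℚ ℚ Y k →+ singularCohomology ℝ ℝ Y k)) = ⊤ := by
  have himage : Set.range (coeffClass (R := ℚ) (S := ℝ) (Rat.castHom ℝ).toAddMonoidHom k :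
        singularCohomology ℚ ℚ Y k →+ singularCohomology ℝ ℝ Y k) =
      (coeffClass (R := ℚ) (S := ℝ) (Rat.castHom ℝ).toAddMonoidHom k :
        singularCohomology ℚ ℚ Y k →+ singularCohomology ℝ ℝ Y k) ''
          ((⊤ : Submodule ℚ (singularCohomology ℚ ℚ Y k)) : Set _) := by
    rw [Submodule.top_coe, Set.image_univ]
  apply Submodule.eq_top_of_finrank_eq
  rw [himage, finrank_span_coeffClass_image_eq, finrank_top,
    finrank_singularCohomology_eq_bettiNumber_of_field ℚ Y k,
    finrank_singularCohomology_eq_bettiNumber_of_field ℝ Y k, bettiNumber_eq_of_algebra ℚ ℝ Y k]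

end Span

section RationalIndices

variable {n : ℕ} {X : Motives.SchemeOver ℂ}

namespace KaehlerRationalDatum

variable (D : KaehlerRationalDatum n X)

/-! ### `b^±(B_ℚ) = b^±(B_ℝ)` -/

/-- **The Sylvester indices of the rational Lefschetz form are those of the real one.** For `X`
smooth projective of dimension `n`, a Kähler–rational datum `D` (rational Kähler class `η`,
`κ = re H_η = η ⊗ ℝ`), any `ℤ`-orientation `μ` of `X(ℂ)` and `k` even, `k + 2r = m`, `m + k = 2n`:
`b⁺` and `b⁻` of `B_ℚ(a, b) = ⟨Lʳ_η a ⌣ b, [X(ℂ)]_μ ⊗ 1_ℚ⟩` on `Hᵏ(X(ℂ); ℚ)` (indices over the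
ordered field `ℚ`) equal those of `B_ℝ(y, y') = ⟨Lʳ_κ y ⌣ y', [X(ℂ)]_μ ⊗ 1_ℝ⟩` on `Hᵏ(X(ℂ); ℝ)`:
`B_ℝ` is the base change of `B_ℚ` (`lefschetzForm_coeffClass_eq_cast`; `ℚ`-independent classes
stay `ℝ`-independent; `dim_ℝ Hᵏ(ℝ) = dim_ℚ Hᵏ(ℚ)`), and the indices of inertia are invariant
under ordered base change (`sigPos_sigNeg_eq_of_baseChange_rat_real`, Sylvester).
[cite: Lang1987LinearAlgebra, Ch. V §8 Thm. 8.2] [cite: VoisinHodgeI2002, §7.1.1 and §6.3.2 Thm. 6.32]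
[cite: HatcherAT2002, §3.A Thm. 3A.3] -/
theorem sigPos_sigNeg_lefschetzFormRat_eq_real (hX : IsSmoothProjective n X)
    {k r m : ℕ} (hk : Even k) (hm : k + 2 * r = m) (hdeg : m + k = 2 * n)
    (μ : HomologicalOrientation ℤ (Motives.ComplexPoints X) (2 * n)) :
    sigPos (LinearMap.BilinMap.toQuadraticMap
        (((cupProduct (R := ℚ) (X := Motives.ComplexPoints X) hdeg).compr₂
          ((kroneckerPairing ℚ ℚ (Motives.ComplexPoints X) (2 * n)).flip
            (singularHomology.coeffChange (Motives.ComplexPoints X)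
              (algebraMap ℤ ℚ : ℤ →+* ℚ).toAddMonoidHom (2 * n) μ.fundamentalClass))) ∘ₗ
          lefschetzPowTo D.η r k m hm)) =
      sigPos (LinearMap.BilinMap.toQuadraticMap
        (((cupProduct (R := ℝ) (X := Motives.ComplexPoints X) hdeg).compr₂
          ((kroneckerPairing ℝ ℝ (Motives.ComplexPoints X) (2 * n)).flip
            (singularHomology.coeffChange (Motives.ComplexPoints X)
              (algebraMap ℤ ℝ : ℤ →+* ℝ).toAddMonoidHom (2 * n) μ.fundamentalClass))) ∘ₗ
          lefschetzPowTo (reClass (Motives.ComplexPoints X) 2 D.Hη) r k m hm)) ∧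
    sigNeg (LinearMap.BilinMap.toQuadraticMap
        (((cupProduct (R := ℚ) (X := Motives.ComplexPoints X) hdeg).compr₂
          ((kroneckerPairing ℚ ℚ (Motives.ComplexPoints X) (2 * n)).flip
            (singularHomology.coeffChange (Motives.ComplexPoints X)
              (algebraMap ℤ ℚ : ℤ →+* ℚ).toAddMonoidHom (2 * n) μ.fundamentalClass))) ∘ₗ
          lefschetzPowTo D.η r k m hm)) =
      sigNeg (LinearMap.BilinMap.toQuadraticMap
        (((cupProduct (R := ℝ) (X := Motives.ComplexPoints X) hdeg).compr₂
          ((kroneckerPairing ℝ ℝ (Motives.ComplexPoints X) (2 * n)).flip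
            (singularHomology.coeffChange (Motives.ComplexPoints X)
              (algebraMap ℤ ℝ : ℤ →+* ℝ).toAddMonoidHom (2 * n) μ.fundamentalClass))) ∘ₗ
          lefschetzPowTo (reClass (Motives.ComplexPoints X) 2 D.Hη) r k m hm)) := by
  classical
  letI := hX.chartedSpace
  haveI := Motives.ComplexPoints.compactSpace_of_isSmoothProjective hX
  haveI := Motives.ComplexPoints.t2Space_of_isSmoothProjective hX
  haveI : Module.Finite ℚ (singularCohomology ℚ ℚ (Motives.ComplexPoints X) k) :=
    finite_singularCohomology_of_compact_chartedSpace ℚ ℚ (d := 2 * n) k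
  haveI : Module.Finite ℝ (singularCohomology ℝ ℝ (Motives.ComplexPoints X) k) :=
    finite_singularCohomology_of_compact_chartedSpace ℝ ℝ (d := 2 * n) k
  set BQ : singularCohomology ℚ ℚ (Motives.ComplexPoints X) k →ₗ[ℚ]
      singularCohomology ℚ ℚ (Motives.ComplexPoints X) k →ₗ[ℚ] ℚ :=
    ((cupProduct hdeg).compr₂ ((kroneckerPairing ℚ ℚ (Motives.ComplexPoints X) (2 * n)).flip
      (singularHomology.coeffChange (Motives.ComplexPoints X)
        (algebraMap ℤ ℚ : ℤ →+* ℚ).toAddMonoidHom (2 * n) μ.fundamentalClass))) ∘ₗ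
      lefschetzPowTo D.η r k m hm with hBQdef
  have hBQ : ∀ x y, BQ x y = kroneckerPairing ℚ ℚ (Motives.ComplexPoints X) (2 * n)
      (cupProduct hdeg (lefschetzPowTo D.η r k m hm x) y)
      (singularHomology.coeffChange (Motives.ComplexPoints X)
        (algebraMap ℤ ℚ : ℤ →+* ℚ).toAddMonoidHom (2 * n) μ.fundamentalClass) :=
    fun x y ↦ by rw [hBQdef, LinearMap.comp_apply, LinearMap.compr₂_apply, LinearMap.flip_apply]
  set BR : singularCohomology ℝ ℝ (Motives.ComplexPoints X) k →ₗ[ℝ]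
      singularCohomology ℝ ℝ (Motives.ComplexPoints X) k →ₗ[ℝ] ℝ :=
    ((cupProduct hdeg).compr₂ ((kroneckerPairing ℝ ℝ (Motives.ComplexPoints X) (2 * n)).flip
      (singularHomology.coeffChange (Motives.ComplexPoints X)
        (algebraMap ℤ ℝ : ℤ →+* ℝ).toAddMonoidHom (2 * n) μ.fundamentalClass))) ∘ₗ
      lefschetzPowTo (reClass (Motives.ComplexPoints X) 2 D.Hη) r k m hm with hBRdef
  have hBR : ∀ x y, BR x y = kroneckerPairing ℝ ℝ (Motives.ComplexPoints X) (2 * n)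
      (cupProduct hdeg (lefschetzPowTo (reClass _ 2 D.Hη) r k m hm x) y)
      (singularHomology.coeffChange (Motives.ComplexPoints X)
        (algebraMap ℤ ℝ : ℤ →+* ℝ).toAddMonoidHom (2 * n) μ.fundamentalClass) :=
    fun x y ↦ by rw [hBRdef, LinearMap.comp_apply, LinearMap.compr₂_apply, LinearMap.flip_apply]
  have hsQ : ∀ x y, BQ x y = BQ y x := fun x y ↦ by
    rw [hBQ, hBQ, lefschetzForm_comm_of_even D.η hk hm hdeg x y]
  have hsR : ∀ x y, BR x y = BR y x := fun x y ↦ by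
    rw [hBR, hBR, lefschetzForm_comm_of_even (reClass _ 2 D.Hη) hk hm hdeg x y]
  set f : singularCohomology ℚ ℚ (Motives.ComplexPoints X) k →+
      singularCohomology ℝ ℝ (Motives.ComplexPoints X) k :=
    coeffClass (R := ℚ) (S := ℝ) (Rat.castHom ℝ).toAddMonoidHom k with hfdef
  have hf : ∀ a b, BR (f a) (f b) = ((BQ a b : ℚ) : ℝ) := fun a b ↦ by
    rw [hBR, hBQ, hfdef]
    exact D.lefschetzForm_coeffClass_eq_cast hm hdeg μ a b
  have hli : ∀ (j : ℕ) (v : Fin j → singularCohomology ℚ ℚ (Motives.ComplexPoints X) k),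
      LinearIndependent ℚ v → LinearIndependent ℝ (f ∘ v) := fun j v hv ↦ by
    rw [hfdef]
    exact linearIndependent_coeffClass_real_of_linearIndependent hv
  have hdim : Module.finrank ℝ (singularCohomology ℝ ℝ (Motives.ComplexPoints X) k) =
      Module.finrank ℚ (singularCohomology ℚ ℚ (Motives.ComplexPoints X) k) := by
    rw [finrank_singularCohomology_eq_bettiNumber_of_field ℚ _ k,
      finrank_singularCohomology_eq_bettiNumber_of_field ℝ _ k, bettiNumber_eq_of_algebra ℚ ℝ _ k]
  obtain ⟨h1, h2⟩ := Literature.LinearAlgebra.QuadraticForm.sigPos_sigNeg_eq_of_baseChange_rat_real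
    BQ ⟨fun x y ↦ hsQ x y⟩ BR ⟨fun x y ↦ hsR x y⟩ f hf hli hdim
  exact ⟨h1.symm, h2.symm⟩

/-! ### The real index theorems, read over `ℚ` -/

/-- **`b^±` of the rational Lefschetz form `Q_k` as block parity sums** (Voisin I Thm. 6.32 over
`ℚ`): for `k` even, `k + r = n`, `μ` positively oriented, `b⁺(B_ℚ) = Σ_{blocks (a,t), types (s,t')}
[s even] dim (H^{s,t'} ∩ Pᵃ)` and `b⁻` the odd-`s` sum (the real statement
`sigPos_sigNeg_lefschetzForm_eq_sum_of_pos`, by `sigPos_sigNeg_lefschetzFormRat_eq_real`).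
[cite: VoisinHodgeI2002, §6.3.2 Thm. 6.32] [cite: Lang1987LinearAlgebra, Ch. V §8 Thm. 8.2] -/
theorem sigPos_sigNeg_lefschetzFormRat_eq_sum_of_pos (hX : IsSmoothProjective n X) (A : HodgeModel n X)
    {k r m : ℕ} (hk : Even k) (hkr : k + r = n) (hm : k + 2 * r = m) (hdeg : m + k = 2 * n)
    (μ : HomologicalOrientation ℤ (Motives.ComplexPoints X) (2 * n))
    (hP : 0 < kroneckerPairing ℝ ℝ (Motives.ComplexPoints X) (2 * n)
      (reClass _ (2 * n) D.topClass)
      (singularHomology.coeffChange (Motives.ComplexPoints X)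
        (algebraMap ℤ ℝ : ℤ →+* ℝ).toAddMonoidHom (2 * n) μ.fundamentalClass)) :
    sigPos (LinearMap.BilinMap.toQuadraticMap
        (((cupProduct (R := ℚ) (X := Motives.ComplexPoints X) hdeg).compr₂
          ((kroneckerPairing ℚ ℚ (Motives.ComplexPoints X) (2 * n)).flip
            (singularHomology.coeffChange (Motives.ComplexPoints X)
              (algebraMap ℤ ℚ : ℤ →+* ℚ).toAddMonoidHom (2 * n) μ.fundamentalClass))) ∘ₗ
          lefschetzPowTo D.η r k m hm)) =
        ∑ P : {p : ℕ × ℕ // p.1 + 2 * p.2 = k}, ∑ st : ↥(Finset.HasAntidiagonal.antidiagonal P.1.1),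
          (if st.1.1 % 2 = 0 then
            Module.finrank ℂ ↥(A.typePiece P.1.1 st ⊓ primitiveClasses D.Hη n P.1.1) else 0) ∧
      sigNeg (LinearMap.BilinMap.toQuadraticMap
        (((cupProduct (R := ℚ) (X := Motives.ComplexPoints X) hdeg).compr₂
          ((kroneckerPairing ℚ ℚ (Motives.ComplexPoints X) (2 * n)).flip
            (singularHomology.coeffChange (Motives.ComplexPoints X)
              (algebraMap ℤ ℚ : ℤ →+* ℚ).toAddMonoidHom (2 * n) μ.fundamentalClass))) ∘ₗ
          lefschetzPowTo D.η r k m hm)) =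
        ∑ P : {p : ℕ × ℕ // p.1 + 2 * p.2 = k}, ∑ st : ↥(Finset.HasAntidiagonal.antidiagonal P.1.1),
          (if st.1.1 % 2 = 1 then
            Module.finrank ℂ ↥(A.typePiece P.1.1 st ⊓ primitiveClasses D.Hη n P.1.1) else 0) := by
  obtain ⟨h1, h2⟩ := D.sigPos_sigNeg_lefschetzFormRat_eq_real hX hk hm hdeg μ
  rw [h1, h2]
  exact D.sigPos_sigNeg_lefschetzForm_eq_sum_of_pos hX A hk hkr hm hdeg μ hP

/-- **`b⁺ + b⁻ = b_k(X)`: the rational Lefschetz form `Q_k` is non-degenerate on `Hᵏ(X(ℂ); ℚ)`**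
for `k` even, `k ≤ n` (`k + r = n`), `μ` positively oriented (the real statement
`sigPos_add_sigNeg_lefschetzForm_eq_finrank` and `dim_ℝ Hᵏ(ℝ) = dim_ℚ Hᵏ(ℚ) = b_k`).
[cite: VoisinHodgeI2002, §6.3.2 Thm. 6.32 and §6.2.3 Cor. 6.26] [cite: HatcherAT2002, §3.A Thm. 3A.3] -/
theorem sigPos_add_sigNeg_lefschetzFormRat_eq_finrank (hX : IsSmoothProjective n X)
    {k r m : ℕ} (hk : Even k) (hkr : k + r = n) (hm : k + 2 * r = m) (hdeg : m + k = 2 * n)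
    (μ : HomologicalOrientation ℤ (Motives.ComplexPoints X) (2 * n))
    (hP : 0 < kroneckerPairing ℝ ℝ (Motives.ComplexPoints X) (2 * n)
      (reClass _ (2 * n) D.topClass)
      (singularHomology.coeffChange (Motives.ComplexPoints X)
        (algebraMap ℤ ℝ : ℤ →+* ℝ).toAddMonoidHom (2 * n) μ.fundamentalClass)) :
    sigPos (LinearMap.BilinMap.toQuadraticMap
        (((cupProduct (R := ℚ) (X := Motives.ComplexPoints X) hdeg).compr₂
          ((kroneckerPairing ℚ ℚ (Motives.ComplexPoints X) (2 * n)).flip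
            (singularHomology.coeffChange (Motives.ComplexPoints X)
              (algebraMap ℤ ℚ : ℤ →+* ℚ).toAddMonoidHom (2 * n) μ.fundamentalClass))) ∘ₗ
          lefschetzPowTo D.η r k m hm)) +
      sigNeg (LinearMap.BilinMap.toQuadraticMap
        (((cupProduct (R := ℚ) (X := Motives.ComplexPoints X) hdeg).compr₂
          ((kroneckerPairing ℚ ℚ (Motives.ComplexPoints X) (2 * n)).flip
            (singularHomology.coeffChange (Motives.ComplexPoints X)
              (algebraMap ℤ ℚ : ℤ →+* ℚ).toAddMonoidHom (2 * n) μ.fundamentalClass))) ∘ₗ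
          lefschetzPowTo D.η r k m hm)) =
      Module.finrank ℚ (singularCohomology ℚ ℚ (Motives.ComplexPoints X) k) := by
  obtain ⟨h1, h2⟩ := D.sigPos_sigNeg_lefschetzFormRat_eq_real hX hk hm hdeg μ
  rw [h1, h2, D.sigPos_add_sigNeg_lefschetzForm_eq_finrank hX hk hkr hm hdeg μ hP,
    finrank_singularCohomology_eq_bettiNumber_of_field ℚ _ k,
    finrank_singularCohomology_eq_bettiNumber_of_field ℝ _ k, bettiNumber_eq_of_algebra ℚ ℝ _ k]

/-- **The signature of the rational Lefschetz form `Q_{2k'}` in Hodge numbers** (Voisin I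
(6.12)–(6.13) / Thm. 6.33 read over `ℚ`): `b⁺ - b⁻ = Σ_{j ≤ k'} Σ_s (-1)^s h^{s,2j-s} + Σ_{j < k'} …`
exactly as for the real form (`signature_lefschetzForm_eq_sum_hodgeNumber`).
[cite: VoisinHodgeI2002, §6.3.2 Thm. 6.32 and Thm. 6.33] [cite: Lang1987LinearAlgebra, Ch. V §8 Thm. 8.2] -/
theorem signature_lefschetzFormRat_eq_sum_hodgeNumber (hX : IsSmoothProjective n X) (A : HodgeModel n X)
    {k' r m : ℕ} (hkr : 2 * k' + r = n) (hm : 2 * k' + 2 * r = m) (hdeg : m + 2 * k' = 2 * n)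
    (μ : HomologicalOrientation ℤ (Motives.ComplexPoints X) (2 * n))
    (hP : 0 < kroneckerPairing ℝ ℝ (Motives.ComplexPoints X) (2 * n)
      (reClass _ (2 * n) D.topClass)
      (singularHomology.coeffChange (Motives.ComplexPoints X)
        (algebraMap ℤ ℝ : ℤ →+* ℝ).toAddMonoidHom (2 * n) μ.fundamentalClass)) :
    ((sigPos (LinearMap.BilinMap.toQuadraticMap
        (((cupProduct (R := ℚ) (X := Motives.ComplexPoints X) hdeg).compr₂
          ((kroneckerPairing ℚ ℚ (Motives.ComplexPoints X) (2 * n)).flip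
            (singularHomology.coeffChange (Motives.ComplexPoints X)
              (algebraMap ℤ ℚ : ℤ →+* ℚ).toAddMonoidHom (2 * n) μ.fundamentalClass))) ∘ₗ
          lefschetzPowTo D.η r (2 * k') m hm)) : ℤ) -
      sigNeg (LinearMap.BilinMap.toQuadraticMap
        (((cupProduct (R := ℚ) (X := Motives.ComplexPoints X) hdeg).compr₂
          ((kroneckerPairing ℚ ℚ (Motives.ComplexPoints X) (2 * n)).flip
            (singularHomology.coeffChange (Motives.ComplexPoints X)
              (algebraMap ℤ ℚ : ℤ →+* ℚ).toAddMonoidHom (2 * n) μ.fundamentalClass))) ∘ₗ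
          lefschetzPowTo D.η r (2 * k') m hm))) =
      ∑ j ∈ range (k' + 1), ∑ s ∈ range (2 * j + 1),
          (-1 : ℤ) ^ s * (Module.finrank ℂ (A.hodgePQ (2 * j) s (2 * j - s)) : ℤ) +
        ∑ j ∈ range k', ∑ s ∈ range (2 * j + 1),
          (-1 : ℤ) ^ s * (Module.finrank ℂ (A.hodgePQ (2 * j) s (2 * j - s)) : ℤ) := by
  obtain ⟨h1, h2⟩ := D.sigPos_sigNeg_lefschetzFormRat_eq_real hX (even_two_mul k') hm hdeg μ
  rw [h1, h2]
  exact D.signature_lefschetzForm_eq_sum_hodgeNumber hX A hkr hm hdeg μ hP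

/-- **Index `(2h^{2,0} + 1, h^{1,1} - 1)` of the rational form `(a · b · η^{n-2})` on
`H²(X(ℂ); ℚ)`** for every smooth projective `n`-fold, `n ≥ 2`, `μ` positively oriented (the real
statement `sigPos_sigNeg_lefschetzForm_two_of_pos`; for a surface this is the index of the rational
intersection form, Huybrechts Cor. 3.3.16). [cite: VoisinHodgeI2002, §6.3.2 Thm. 6.32 and Thm. 6.33]
[cite: HuybrechtsCG2005, §3.3 Cor. 3.3.16] [cite: Lang1987LinearAlgebra, Ch. V §8 Thm. 8.2] -/
theorem sigPos_sigNeg_lefschetzFormRat_two_of_pos (hX : IsSmoothProjective n X) (A : HodgeModel n X)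
    {r m : ℕ} (hr : 2 + r = n) (hm : 2 + 2 * r = m) (hdeg : m + 2 = 2 * n)
    (μ : HomologicalOrientation ℤ (Motives.ComplexPoints X) (2 * n))
    (hP : 0 < kroneckerPairing ℝ ℝ (Motives.ComplexPoints X) (2 * n)
      (reClass _ (2 * n) D.topClass)
      (singularHomology.coeffChange (Motives.ComplexPoints X)
        (algebraMap ℤ ℝ : ℤ →+* ℝ).toAddMonoidHom (2 * n) μ.fundamentalClass)) :
    sigPos (LinearMap.BilinMap.toQuadraticMap
        (((cupProduct (R := ℚ) (X := Motives.ComplexPoints X) hdeg).compr₂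
          ((kroneckerPairing ℚ ℚ (Motives.ComplexPoints X) (2 * n)).flip
            (singularHomology.coeffChange (Motives.ComplexPoints X)
              (algebraMap ℤ ℚ : ℤ →+* ℚ).toAddMonoidHom (2 * n) μ.fundamentalClass))) ∘ₗ
          lefschetzPowTo D.η r 2 m hm)) =
        2 * Module.finrank ℂ (A.hodgePQ 2 2 0) + 1 ∧
      sigNeg (LinearMap.BilinMap.toQuadraticMap
        (((cupProduct (R := ℚ) (X := Motives.ComplexPoints X) hdeg).compr₂
          ((kroneckerPairing ℚ ℚ (Motives.ComplexPoints X) (2 * n)).flip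
            (singularHomology.coeffChange (Motives.ComplexPoints X)
              (algebraMap ℤ ℚ : ℤ →+* ℚ).toAddMonoidHom (2 * n) μ.fundamentalClass))) ∘ₗ
          lefschetzPowTo D.η r 2 m hm)) + 1 =
        Module.finrank ℂ (A.hodgePQ 2 1 1) := by
  obtain ⟨h1, h2⟩ := D.sigPos_sigNeg_lefschetzFormRat_eq_real hX (k := 2) ⟨1, rfl⟩ hm hdeg μ
  rw [h1, h2]
  exact D.sigPos_sigNeg_lefschetzForm_two_of_pos hX A hr hm hdeg μ hP

end KaehlerRationalDatum

end RationalIndices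

end Literature.AlgebraicGeometry.HodgeTheory

end
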